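import Summits.QuantumAdvantage.QuantumAdvantage.Theorems.LinnikCubicClassGroupsDegreeOnePrimesEscapeFrobeniusPsi
import Summits.QuantumAdvantage.QuantumAdvantage.Theorems.LinnikCubicClassGroupsDegreeOnePrimesEscapeClassPNTDHLinnik
import HarnessLib

/-!
# The least prime ideal with prescribed Frobenius in a cyclic extension, unconditionally

Topic `Summits/QuantumAdvantage/QuantumAdvantage/Theorems`, cell B2b-1 (linnik-cubic), PART A (gen 12); helper
toward the crux `DegreeOnePrimesEscape` (stmt-QuantumAdvantage-11543) — a corollary of the LMO programme for
conjugacy classes inside a division.  HONEST FRAMING: the value of this file is a THEOREM (kernel-checked, GRH-free)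
— NOT summit progress.

**Theorem** (`exists_prime_galFrob_eq_absNorm_le`, Linnik–Fogels–Weiss for cyclic extensions).  For `n > 1` there is
`L = L(n) > 0` such that for every cyclic extension `N|E` of number fields with `[N:ℚ] = n`, `1 < [E:ℚ]`, and every
`τ ∈ Gal(N|E)`, some prime `𝔭` of `E`, unramified in `N`, has `Frob_𝔭 = τ` and `N𝔭 ≤ Q^{L}`, `Q = |d_N| nⁿ`.
[Weiss1983, Theorem 6.1 (abelian extensions; here the cyclic case)]; [LagariasMontgomeryOdlyzko1979, Theorem 1.1].

Proof: `frobeniusPsi_dichotomy` with `η = 1/16` gives `m ψ_τ(x) ≥ (3/16) x · min(1, (1−β₁) log x) ≥ (3/16) c₁ x Q^{−2}`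
(Stark's `1 − β₁ ≥ c₁ Q^{−2}`, `Residue.one_sub_realZero_ge_condQn_rpow`; the main term via `sub_mul_rpow_div_ge`),
while the prime powers `𝔭^k`, `k ≥ 2`, contribute at most `m(ψ_E − θ_E)(x) ≤ 2 n √x log x`
(`chebyshevPsiIdeal_sub_chebyshevThetaIdeal_le`); at `x = Q^{L}` the former exceeds the latter.
-/

noncomputable section

open Complex Real Finset NumberField IsDedekindDomain
open scoped NumberField nonZeroDivisors Classical

namespace Summit.QuantumAdvantage.QuantumAdvantage.Theorems.DegreeOnePrimesEscape

open Literature.NumberTheory.LFunctions Literature.NumberTheory.LFunctions.NumberField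
  Literature.NumberTheory.LFunctions.EntireEF Literature.NumberTheory.LFunctions.TZWeight
  Literature.NumberTheory.LFunctions.AbelianDensity Literature.NumberTheory.GaloisRepresentations

variable {E N : Type} [Field E] [NumberField E] [Field N] [NumberField N] [Algebra E N] [IsGalois E N]

/-- **From prime powers to primes.**  If no prime `𝔭` of `E` of norm `≤ x`, unramified in `N`, has `Frob_𝔭 = τ`, then
`ψ_τ(x) ≤ ψ_E(x) − θ_E(x)` (only the powers `𝔭^k`, `k ≥ 2`, contribute to `ψ_τ`). -/
theorem psiWeighted_le_psi_sub_theta_of_forall (τ : N ≃ₐ[E] N) {wτ : Ideal (𝓞 E) → ℝ}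
    (hwτ : ∀ I, wτ I = if (∃ v : HeightOneSpectrum (𝓞 E), Algebra.IsUnramifiedIn (𝓞 N) v.asIdeal ∧
      ∃ k : ℕ, I = v.asIdeal ^ k ∧ galFrob E N v ^ k = τ) then 1 else 0)
    {x : ℝ} (hx : 0 ≤ x)
    (hno : ∀ v : HeightOneSpectrum (𝓞 E), Algebra.IsUnramifiedIn (𝓞 N) v.asIdeal → galFrob E N v = τ →
      x < (Ideal.absNorm v.asIdeal : ℝ)) :
    (∑ n ∈ Icc 0 ⌊x⌋₊, ∑ I ∈ idealsOfNorm E n, wτ I * idealVonMangoldt I) ≤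
      chebyshevPsiIdeal E x - chebyshevThetaIdeal E x := by
  classical
  rw [chebyshevPsiIdeal_eq_sum_vonMangoldtNorm, chebyshevThetaIdeal_eq_sum_primeIdealsLE E hx]
  set S := (finite_primeIdealsLE E x).toFinset with hS
  set U := (Icc 0 ⌊x⌋₊).biUnion (idealsOfNorm E) with hU
  have hdisj : Set.PairwiseDisjoint (↑(Icc 0 ⌊x⌋₊) : Set ℕ) (idealsOfNorm E) := by
    intro m _ n _ hmn
    rw [Function.onFun, Finset.disjoint_left]
    intro I hIm hIn
    rw [mem_idealsOfNorm] at hIm hIn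
    exact hmn (hIm.symm.trans hIn)
  have hsub : S ⊆ U := by
    intro P hP
    rw [hS, Set.Finite.mem_toFinset] at hP
    obtain ⟨-, -, hle⟩ := hP
    rw [hU, Finset.mem_biUnion]
    exact ⟨Ideal.absNorm P, mem_Icc.mpr ⟨Nat.zero_le _, Nat.le_floor hle⟩, by rw [mem_idealsOfNorm]⟩
  unfold vonMangoldtNorm
  rw [← Finset.sum_biUnion hdisj, ← Finset.sum_biUnion hdisj]
  -- `θ_E(x) = Σ_{I ∈ U} [I ∈ S] Λ(I)`
  have hθ : ∑ P ∈ S, Real.log (Ideal.absNorm P : ℝ) = ∑ I ∈ U, if I ∈ S then idealVonMangoldt I else 0 := by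
    rw [← Finset.sum_filter, Finset.filter_mem_eq_inter, Finset.inter_eq_right.mpr hsub]
    refine Finset.sum_congr rfl fun P hP ↦ ?_
    rw [hS, Set.Finite.mem_toFinset] at hP
    obtain ⟨hprime, hP0, -⟩ := hP
    have := idealVonMangoldt_prime_pow (Ideal.prime_of_isPrime hP0 hprime) one_ne_zero
    rw [pow_one] at this; rw [this]
  rw [hθ, le_sub_iff_add_le, ← Finset.sum_add_distrib]
  refine Finset.sum_le_sum fun I hI ↦ ?_
  have hΛ := idealVonMangoldt_nonneg I
  rw [hwτ I]
  split_ifs with h1 h2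
  · -- `I` is a prime with `Frob = τ`: excluded by `hno`
    exfalso
    obtain ⟨v, hunr, k, hIk, hk⟩ := h1
    rw [hS, Set.Finite.mem_toFinset] at h2
    obtain ⟨hprime, hI0, hle⟩ := h2
    -- `I = v^k` prime forces `k = 1`
    have hk1 : k = 1 := by
      have hv := (heightOneSpectrum_pow_eq_pow (v := ⟨I, hprime, hI0⟩) (v' := v) (m := 1) (k := k) one_pos
        (by rw [pow_one]; exact hIk)).2
      exact hv.symm
    rw [hk1, pow_one] at hk hIk
    exact absurd hle (not_le.mpr (by rw [hIk]; exact hno v hunr hk))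
  · linarith
  · linarith
  · linarith

set_option maxHeartbeats 1600000 in
/-- **The least prime ideal with prescribed Frobenius in a cyclic extension** (see the module docstring).
[cite: Weiss1983, Theorem 6.1] [cite: LagariasMontgomeryOdlyzko1979, Theorem 1.1] -/
theorem exists_prime_galFrob_eq_absNorm_le (n₀ : ℕ) (hn₀ : 1 < n₀) :
    ∃ L : ℝ, 0 < L ∧
    ∀ (E N : Type) [Field E] [NumberField E] [Field N] [NumberField N] [Algebra E N] [IsGalois E N]
      [IsCyclic (N ≃ₐ[E] N)], Module.finrank ℚ N = n₀ → 1 < Module.finrank ℚ E →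
    ∀ τ : N ≃ₐ[E] N, ∃ v : HeightOneSpectrum (𝓞 E), Algebra.IsUnramifiedIn (𝓞 N) v.asIdeal ∧
      galFrob E N v = τ ∧ (Ideal.absNorm v.asIdeal : ℝ) ≤ ThornerZaman.condQn N ^ L := by
  classical
  obtain ⟨a₂, c, ha₂1, hc, hcn, hmain⟩ := frobeniusPsi_dichotomy n₀ hn₀ (by norm_num : (0 : ℝ) < 1 / 16)
  obtain ⟨c₁, hc₁, hc₁1, heff⟩ := Residue.one_sub_realZero_ge_condQn_rpow n₀ hn₀
  have hn2 : (2 : ℝ) ≤ n₀ := by exact_mod_cast hn₀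
  -- threshold: `log x ≥ 16` and `(512 n₀/(3 c₁)) Q² x^{-1/4} ≤ 1`
  set Λp : ℝ := max 0 (Real.log (512 * n₀ / (3 * c₁))) with hΛp
  set L : ℝ := max a₂ (max 32 (4 * (2 + Λp))) with hLdef
  have hLa₂ : a₂ ≤ L := le_max_left _ _
  have hL32 : (32 : ℝ) ≤ L := le_trans (le_max_left _ _) (le_max_right _ _)
  have hLp : 4 * (2 + Λp) ≤ L := le_trans (le_max_right _ _) (le_max_right _ _)
  refine ⟨L, by linarith, ?_⟩
  intro E N _ _ _ _ _ _ _ hNn hE τ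
  obtain ⟨χ₁, hχ₁, hcaseA, hcaseB⟩ := hmain E N hNn hE
  haveI : FiniteDimensional E N := Module.Finite.of_restrictScalars_finite ℚ E N
  have hN : 1 < Module.finrank ℚ N := by rw [hNn]; exact hn₀
  set mN : ℕ := Module.finrank E N with hmN
  have hm1 : 1 ≤ mN := Module.finrank_pos
  have hdeg : Module.finrank ℚ N = Module.finrank ℚ E * mN := (Module.finrank_mul_finrank ℚ E N).symm
  have hmn₀ : (mN : ℝ) ≤ n₀ := by
    have : mN ≤ n₀ := by rw [← hNn, hdeg]; exact Nat.le_mul_of_pos_left _ Module.finrank_pos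
    exact_mod_cast this
  have hnEn₀ : (Module.finrank ℚ E : ℝ) ≤ n₀ := by
    have : Module.finrank ℚ E ≤ n₀ := by rw [← hNn, hdeg]; exact Nat.le_mul_of_pos_right _ hm1
    exact_mod_cast this
  set Q : ℝ := ThornerZaman.condQn N with hQ
  have hQ12 : (12 : ℝ) ≤ Q := ThornerZaman.twelve_le_condQn (K := N) hN
  have hQ1 : (1 : ℝ) < Q := by linarith
  have hQ0 : (0 : ℝ) < Q := by linarith
  have hlogQ : 2 ≤ Real.log Q := two_lt_log_twelve.le.trans (Real.log_le_log (by norm_num) hQ12)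
  set x : ℝ := Q ^ L with hxdef
  have hxa₂ : Q ^ a₂ ≤ x := Real.rpow_le_rpow_of_exponent_le hQ1.le hLa₂
  have hxQ : Q ≤ x := by
    have := Real.rpow_le_rpow_of_exponent_le hQ1.le (by linarith : (1 : ℝ) ≤ L); rwa [Real.rpow_one] at this
  have hx1 : 1 < x := by linarith
  have hx0 : 0 < x := by linarith
  have hLx : L * Real.log Q = Real.log x := by rw [hxdef, Real.log_rpow hQ0]
  have hlog16 : 16 ≤ Real.log x := by rw [← hLx]; nlinarith
  -- Stark: `m' = c₁ Q^{-2}`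
  set m' : ℝ := c₁ * Q ^ (-(2 : ℝ)) with hm'
  have hQm2 : Q ^ (-(2 : ℝ)) ≤ 1 := Real.rpow_le_one_of_one_le_of_nonpos hQ1.le (by norm_num)
  have hQm2' : 0 < Q ^ (-(2 : ℝ)) := Real.rpow_pos_of_pos hQ0 _
  have hm'0 : 0 < m' := mul_pos hc₁ hQm2'
  have hm'1 : m' ≤ 1 := (mul_le_mul hc₁1 hQm2 hQm2'.le zero_le_one).trans (by norm_num)
  -- the weight
  set wτ : Ideal (𝓞 E) → ℝ := fun I ↦ if (∃ v : HeightOneSpectrum (𝓞 E), Algebra.IsUnramifiedIn (𝓞 N) v.asIdeal ∧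
      ∃ k : ℕ, I = v.asIdeal ^ k ∧ galFrob E N v ^ k = τ) then 1 else 0 with hwτdef
  have hwτ : ∀ I, wτ I = if (∃ v : HeightOneSpectrum (𝓞 E), Algebra.IsUnramifiedIn (𝓞 N) v.asIdeal ∧
      ∃ k : ℕ, I = v.asIdeal ^ k ∧ galFrob E N v ^ k = τ) then 1 else 0 := fun I ↦ rfl
  set Ψ : ℝ := ∑ n ∈ Icc 0 ⌊x⌋₊, ∑ I ∈ idealsOfNorm E n, wτ I * idealVonMangoldt I with hΨ
  -- LOWER BOUND: `m Ψ ≥ (3/16) x m'`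
  have hlow : 3 / 16 * x * m' ≤ (mN : ℝ) * Ψ := by
    by_cases hexc : ∃ β₁ : ℝ, dedekindZeta₁ N β₁ = 0 ∧
        1 - c / (Real.log ((NumberField.discr N).natAbs : ℝ) + Real.log 4) < β₁ ∧ β₁ < 1
    · obtain ⟨β₁, hζ, hwin, hβ1⟩ := hexc
      obtain ⟨j₀, -, hB⟩ := hcaseB β₁ hζ hwin hβ1
      have h1 := hB τ wτ hwτ x hxa₂
      set r : ℝ := ((((χ₁ τ : ℂˣ) : ℂ)⁻¹) ^ j₀).re with hr
      have hrle : |r| ≤ 1 := by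
        refine (Complex.abs_re_le_norm _).trans ?_
        rw [norm_pow]; exact pow_le_one₀ (norm_nonneg _) (norm_inv_character_le_one χ₁ τ)
      -- Stark
      have hβ1ne : ((β₁ : ℝ) : ℂ) ≠ 1 := by intro h'; apply hβ1.ne; exact_mod_cast h'
      have hLzero : classGroupLFunction N 1 β₁ = 0 := by
        have := classGroupLFunction_eq_zero_of_famF (K := N) 0 (ρ := (β₁ : ℂ)) (by rw [famF_zero]; exact hζ) hβ1ne
        rwa [toHomUnits_toMulHom_zero] at this
      have h11 : (1 : ClassGroup (𝓞 N) →* ℂˣ) * 1 = 1 := by ext; simp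
      have hδlow : m' ≤ 1 - β₁ := heff N hNn 1 h11 β₁ hβ1 hLzero
      have hβhalf : 1 / 2 ≤ β₁ := by
        have hlog4 : 1 < Real.log 4 := by
          rw [show (4:ℝ) = 2 ^ 2 by norm_num, Real.log_pow]; have := Real.log_two_gt_d9; push_cast; linarith
        have hlogd : 0 ≤ Real.log ((NumberField.discr N).natAbs : ℝ) := Real.log_natCast_nonneg _
        have hc2 : c ≤ 1 / 2 :=
          hcn.trans (by rw [div_le_div_iff_of_pos_left one_pos (by positivity) (by norm_num)]; nlinarith)
        have : c / (Real.log ((NumberField.discr N).natAbs : ℝ) + Real.log 4) ≤ 1 / 2 := by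
          rw [div_le_iff₀ (by linarith)]; nlinarith
        linarith
      have hβ0 : 0 < β₁ := by linarith
      set mm : ℝ := min 1 ((1 - β₁) * Real.log x) with hmm
      have hmm' : m' ≤ mm := by
        refine le_min hm'1 (hδlow.trans ?_)
        have := mul_le_mul_of_nonneg_left (by linarith : (1 : ℝ) ≤ Real.log x) (by linarith : (0 : ℝ) ≤ 1 - β₁)
        linarith
      have hmm1 : mm ≤ 1 := min_le_left _ _
      have hmm0 : 0 ≤ mm := hm'0.le.trans hmm'
      have h1' := (abs_sub_le_iff.1 h1).2
      -- main term `x − r x^{β₁}/β₁ ≥ (x/4) mm`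
      have hmain : x / 4 * mm ≤ x - r * x ^ β₁ / β₁ := by
        rcases le_or_gt (3 / 4 : ℝ) β₁ with hβ34 | hβ34
        · exact sub_mul_rpow_div_ge hx1 hlog16 hβ34 hβ1 hrle
        · -- `β₁ < 3/4`: `x^{β₁}/β₁ ≤ 2 x^{3/4} ≤ x/2`
          have hxβ : x ^ β₁ ≤ x ^ (3 / 4 : ℝ) := Real.rpow_le_rpow_of_exponent_le hx1.le hβ34.le
          have hx34 : x ^ (3 / 4 : ℝ) * 4 ≤ x := by
            -- `x^{1/4} ≥ e^4 ≥ 4`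
            have h14 : (4 : ℝ) ≤ x ^ (1 / 4 : ℝ) := by
              have : Real.exp 4 ≤ x ^ (1 / 4 : ℝ) := by
                rw [Real.rpow_def_of_pos hx0]; exact Real.exp_le_exp.2 (by nlinarith)
              linarith [Real.add_one_le_exp (4 : ℝ)]
            have e : x ^ (3 / 4 : ℝ) * x ^ (1 / 4 : ℝ) = x := by
              rw [← Real.rpow_add hx0]; norm_num
            nlinarith [Real.rpow_pos_of_pos hx0 (3 / 4 : ℝ)]
          have hr1 : r ≤ 1 := (abs_le.1 hrle).2
          have hxβ0 : 0 < x ^ β₁ := Real.rpow_pos_of_pos hx0 _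
          have hq : r * x ^ β₁ / β₁ ≤ 2 * x ^ β₁ := by
            rw [div_le_iff₀ hβ0]
            nlinarith
          have : x / 4 * mm ≤ x / 4 := by nlinarith
          nlinarith
      have hmm16 : 1 / 16 * x * mm ≥ 0 := by positivity
      nlinarith [mul_le_mul_of_nonneg_left hmm' (by positivity : (0:ℝ) ≤ 3 / 16 * x)]
    · have h1 := hcaseA τ wτ hwτ x hxa₂ hexc
      have h1' := (abs_sub_le_iff.1 h1).2
      have : 3 / 16 * x * m' ≤ 3 / 16 * x := by nlinarith
      linarith
  -- UPPER BOUND for the prime powers `k ≥ 2`: `m (ψ_E − θ_E)(x) ≤ 2 n₀ √x log x < (3/16) x m'`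
  have hpp : (mN : ℝ) * (chebyshevPsiIdeal E x - chebyshevThetaIdeal E x) < 3 / 16 * x * m' := by
    have h1 := chebyshevPsiIdeal_sub_chebyshevThetaIdeal_le E hx1.le
    have h2 := primeIdealCount_le_two_mul_finrank_mul E (Real.sqrt_nonneg x)
    have hlogx0 : 0 ≤ Real.log x := Real.log_nonneg hx1.le
    have h3 : (mN : ℝ) * (chebyshevPsiIdeal E x - chebyshevThetaIdeal E x) ≤ 2 * n₀ * Real.sqrt x * Real.log x := by
      calc (mN : ℝ) * (chebyshevPsiIdeal E x - chebyshevThetaIdeal E x)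
          ≤ mN * ((2 * Module.finrank ℚ E * Real.sqrt x) * Real.log x) :=
            mul_le_mul_of_nonneg_left (h1.trans (mul_le_mul_of_nonneg_right h2 hlogx0)) (Nat.cast_nonneg _)
        _ = 2 * (Module.finrank ℚ E * mN) * Real.sqrt x * Real.log x := by ring
        _ = 2 * n₀ * Real.sqrt x * Real.log x := by
            rw [show (Module.finrank ℚ E : ℝ) * mN = n₀ by rw [← hNn, hdeg]; push_cast; ring]
    -- `log x ≤ 4 x^{1/4}` and `√x · x^{1/4} = x^{3/4} = x · x^{-1/4}`
    have hlog : Real.log x ≤ x ^ (1 / 4 : ℝ) / (1 / 4) := Real.log_le_rpow_div hx0.le (by norm_num)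
    have hth := mul_rpow_neg_le_one_of_threshold (k := 2) (M := 512 * n₀ / (3 * c₁)) (ν := 1 / 4) hQ12
      (le_of_eq hxdef.symm) (by norm_num) (by positivity) (by rw [← hΛp]; linarith)
    have hsq : Real.sqrt x * x ^ (1 / 4 : ℝ) = x * x ^ (-(1 / 4 : ℝ)) := by
      rw [Real.sqrt_eq_rpow, ← Real.rpow_add hx0, ← Real.rpow_one_add' hx0.le (by norm_num)]; norm_num
    have hm'2 : m' = c₁ * (Q ^ (2 : ℝ))⁻¹ := by rw [hm', Real.rpow_neg hQ0.le]
    calc (mN : ℝ) * (chebyshevPsiIdeal E x - chebyshevThetaIdeal E x)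
        ≤ 2 * n₀ * Real.sqrt x * Real.log x := h3
      _ ≤ 2 * n₀ * Real.sqrt x * (x ^ (1 / 4 : ℝ) / (1 / 4)) := mul_le_mul_of_nonneg_left hlog (by positivity)
      _ = 8 * n₀ * (x * x ^ (-(1 / 4 : ℝ))) := by rw [← hsq]; ring
      _ = (512 * n₀ / (3 * c₁) * Q ^ (2 : ℝ) * x ^ (-(1 / 4 : ℝ))) * (3 / 64 * x * m') := by
          rw [hm'2]; field_simp; ring
      _ ≤ 1 * (3 / 64 * x * m') := mul_le_mul_of_nonneg_right hth (by positivity)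
      _ < 3 / 16 * x * m' := by have : 0 < x * m' := mul_pos hx0 hm'0; linarith
  -- conclusion
  by_contra hno
  push Not at hno
  have hle := psiWeighted_le_psi_sub_theta_of_forall τ hwτ hx0.le hno
  have := mul_le_mul_of_nonneg_left hle (Nat.cast_nonneg mN)
  linarith

end Summit.QuantumAdvantage.QuantumAdvantage.Theorems.DegreeOnePrimesEscape
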